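import Summits.Ventures.PercRepro.PuncturedLYMAllJ

/-!
# PercRepro — (SP) BY SUPERPOSITION, PART 16b: THE POINTED LINE PER MATROID — (H-gen) AND (PM-flat) FOR EVERY SPARSE
PAVING MATROID (p10, gen 32)

The gen-29 bridges `(NC) ⟹ (H-gen) ⟹ (PM-flat)` are stated for the global conjectures (`NormCons α`, `UpsetMirror α`,
`SepMirror α`, `BiIndepFlatSup α`); their proofs use the hypothesis at ONE matroid only.  This file states the same
conjectures AT ONE MATROID (`UpsetMirrorAt`, `SepMirrorAt`, `BiIndepFlatSupAt`, `BiIndepFlatSupHallAt`), re-proves the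
bridges per matroid (`upsetMirrorAt_of_normConsAt`, `sepMirrorAt_of_upsetMirrorAt`, `flatSupHallAt_of_upsetMirrorAt`,
`flatSupAt_of_flatSupHallAt`) and concludes from THEOREM G (`normConsAt_of_sparsePaving_all`):
* **`upsetMirrorAt_of_sparsePaving`**, **`sepMirrorAt_of_sparsePaving`** — (H-gen) holds for every sparse paving matroid
  with `r + 1 ≤ n ≤ 2r − 2`: for every up-set `U` of flats and `2k < n`, `u_k(U) ≤ u_{n−k}(U)` (and `s_k(U) ≤ s_{n−k}(U)`);
* **`biIndepFlatSupAt_of_sparsePaving`** — (PM-flat) holds for every such matroid: an injection `BI_k → BI_{n−k}` along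
  flat containment, for every `2k < n`.
Nothing here asserts the global conjectures.
-/

open scoped Matroid

namespace PercRepro.Cogirth

open Finset ThmH Skew

variable {α : Type} [DecidableEq α] {M : Matroid α} [M.Finite]

/-- (H-gen) at one matroid, closure form: `u_k(U) ≤ u_{n−k}(U)` for every up-set `U` of flats and `2k < n`. -/
def UpsetMirrorAt (M : Matroid α) [M.Finite] : Prop :=
  ∀ (U : Finset (Finset α)), UpFlats M U → ∀ k : ℕ, 2 * k < (gr M).card →
    ((biIndepSets M k).filter (fun X => clF M X ∈ U)).card ≤
      ((biIndepSets M ((gr M).card - k)).filter (fun X => clF M X ∈ U)).card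

/-- (H-gen) at one matroid, separated-set form. -/
def SepMirrorAt (M : Matroid α) [M.Finite] : Prop :=
  ∀ (U : Finset (Finset α)), UpFlats M U → ∀ k : ℕ, 2 * k < (gr M).card →
    sepCount M U k ≤ sepCount M U ((gr M).card - k)

/-- (PM-flat) at one matroid: an injection `BI_k → BI_{n−k}` along flat containment, for every `2k < n`. -/
def BiIndepFlatSupAt (M : Matroid α) [M.Finite] : Prop :=
  ∀ k : ℕ, 2 * k < (gr M).card →
    ∃ f : Finset α → Finset α, Set.InjOn f (biIndepSets M k) ∧
      ∀ X ∈ biIndepSets M k, f X ∈ biIndepSets M ((gr M).card - k) ∧ clF M X ⊆ clF M (f X)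

/-- (PM-flat) at one matroid, Hall form. -/
def BiIndepFlatSupHallAt (M : Matroid α) [M.Finite] : Prop :=
  ∀ k : ℕ, 2 * k < (gr M).card →
    ∀ 𝒜 ⊆ biIndepSets M k, 𝒜.card ≤ (flatNbrs M 𝒜 ((gr M).card - k)).card

/-- **(NC) at `M` ⟹ (H-gen) at `M`**: the telescoped densities and `P_k = P_{n−k}`. -/
theorem upsetMirrorAt_of_normConsAt (h : NormConsAt M) : UpsetMirrorAt M := by
  intro U hU k hk
  have h1 := upCount_mul_le_of_normCons_steps (M := M) (U := U) (h U hU) (k := k) (k' := (gr M).card - k)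
    (by omega) (by omega)
  rw [← card_biIndepSets_symm M (k := k) (by omega)] at h1
  change upCount M U k ≤ upCount M U ((gr M).card - k)
  rcases Nat.eq_zero_or_pos (biIndepSets M k).card with h0 | hpos
  · rw [upCount_eq_zero_of_card_eq_zero h0]
    exact Nat.zero_le _
  · exact Nat.le_of_mul_le_mul_right h1 hpos

/-- (H-gen) at `M`, closure form ⟹ separated-set form. -/
theorem sepMirrorAt_of_upsetMirrorAt (h : UpsetMirrorAt M) : SepMirrorAt M := by
  intro U hU k hk
  have h1 := h U hU k hk
  have h2 := sepCount_le_mirror_iff_upCount_le (M := M) U (k := k) (by omega)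
  unfold upCount at h2
  exact h2.2 h1

/-- (H-gen) at `M` gives Hall's condition for the flat-containment graph of `M`. -/
theorem flatSupHallAt_of_upsetMirrorAt (h : UpsetMirrorAt M) : BiIndepFlatSupHallAt M := by
  intro k hk 𝒜 h𝒜
  have h1 := h (genUpset M 𝒜) (upFlats_genUpset 𝒜) k hk
  rw [filter_clF_mem_genUpset_eq, filter_clF_mem_genUpset_eq] at h1
  refine le_trans ?_ h1
  apply card_le_card
  intro X hX
  unfold flatNbrs
  rw [mem_filter]
  exact ⟨h𝒜 hX, X, hX, Subset.refl _⟩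

/-- The Hall form of (PM-flat) at `M` gives the injection form (Mathlib's Hall theorem). -/
theorem flatSupAt_of_flatSupHallAt (h : BiIndepFlatSupHallAt M) : BiIndepFlatSupAt M := by
  intro k hk
  have hH := h k hk
  let T : Finset (Finset α) := biIndepSets M ((gr M).card - k)
  let t : {X // X ∈ biIndepSets M k} → Finset (Finset α) := fun X => T.filter (fun X' => clF M X.1 ⊆ clF M X')
  have hall : ∀ s : Finset {X // X ∈ biIndepSets M k}, s.card ≤ (s.biUnion t).card := by
    intro s
    have h1 := hH (s.map (Function.Embedding.subtype _)) (by
      intro X hX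
      rw [mem_map] at hX
      obtain ⟨Y, _, rfl⟩ := hX
      exact Y.2)
    rw [card_map] at h1
    refine h1.trans (card_le_card ?_)
    intro X' hX'
    unfold flatNbrs at hX'
    rw [mem_filter] at hX'
    obtain ⟨hX'T, Y, hY, hYX'⟩ := hX'
    rw [mem_map] at hY
    obtain ⟨Z, hZ, rfl⟩ := hY
    rw [mem_biUnion]
    refine ⟨Z, hZ, ?_⟩
    simp only [t, mem_filter]
    exact ⟨hX'T, hYX'⟩
  obtain ⟨f, hfinj, hft⟩ := (all_card_le_biUnion_card_iff_existsInjective' t).1 hall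
  refine ⟨fun X => if hX : X ∈ biIndepSets M k then f ⟨X, hX⟩ else X, ?_, ?_⟩
  · intro X hX Y hY hXY
    have hX' : X ∈ biIndepSets M k := hX
    have hY' : Y ∈ biIndepSets M k := hY
    dsimp only at hXY
    rw [dif_pos hX', dif_pos hY'] at hXY
    exact congrArg Subtype.val (hfinj hXY)
  · intro X hX
    dsimp only
    rw [dif_pos hX]
    have h1 := hft ⟨X, hX⟩
    simp only [t, mem_filter] at h1
    exact h1


/-! ### For every sparse paving matroid -/

/-- **(H-gen) for every sparse paving matroid** with `r + 1 ≤ n ≤ 2r − 2` (closure form), from THEOREM G. -/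
theorem upsetMirrorAt_of_sparsePaving {r : ℕ} (hsp : IsSparsePavingF M r) (hr1 : r + 1 ≤ (gr M).card)
    (hn : (gr M).card + 2 ≤ 2 * r) : UpsetMirrorAt M :=
  upsetMirrorAt_of_normConsAt (normConsAt_of_sparsePaving_all hsp hr1 hn)

/-- **(H-gen) for every sparse paving matroid** with `r + 1 ≤ n ≤ 2r − 2` (separated-set form). -/
theorem sepMirrorAt_of_sparsePaving {r : ℕ} (hsp : IsSparsePavingF M r) (hr1 : r + 1 ≤ (gr M).card)
    (hn : (gr M).card + 2 ≤ 2 * r) : SepMirrorAt M :=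
  sepMirrorAt_of_upsetMirrorAt (upsetMirrorAt_of_sparsePaving hsp hr1 hn)

/-- **(PM-flat) for every sparse paving matroid** with `r + 1 ≤ n ≤ 2r − 2`: an injection `BI_k → BI_{n−k}` along flat
containment for every `2k < n`. -/
theorem biIndepFlatSupAt_of_sparsePaving {r : ℕ} (hsp : IsSparsePavingF M r) (hr1 : r + 1 ≤ (gr M).card)
    (hn : (gr M).card + 2 ≤ 2 * r) : BiIndepFlatSupAt M :=
  flatSupAt_of_flatSupHallAt (flatSupHallAt_of_upsetMirrorAt (upsetMirrorAt_of_sparsePaving hsp hr1 hn))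

end PercRepro.Cogirth
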